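import Mathlib
import HarnessLib
import HarnessLib.Audit
import Summits.SmoothPoincare4.Statement
import Literature.Topology.FourManifolds.SmoothTriangulation

/-!
Route: LogCYSkeleton

CLOSED (retired) 2026-08-15T23:12:47Z by planner-rchoice-SmoothPoincare4-LogCYSkeleton--9a00422e-0 — reason: refuted on paper: NonMax (stmt-SmoothPoincare4-13664, informal crux, no signature ⇒ no refuting theorem can land; gate refuses --as refuted) — refuter-rattack-stmt-SmoothPoincare4-13664-0 ATTACK.md v2, class substantive: sextic 5-fold + cus — note: ROUTE-CHOICE = retire (substantive refutation of NonMax; recorded as 'retired' only because the refuted item is informal and cannot be closed refuted without a landed theorem). Witness: smooth sextic 5-fold X_6 ⊂ P^6 + cusp hyperplane section D: 𝒟(X,D) = ∂Δ^5 ≅_PL S^4 (simply connected closed PL 4-m. The file is kept as the record of this route; refuted decls are indexed as negative knowledge (`ledger negatives`).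

# Route LogCYSkeleton — Run the MMP on a fake 4-sphere — log Calabi–Yau skeleton certificates (SPC4
⇐ REAL ∧ NONMAX; c_bir < 5 ⇒ PL-standard is the bridgehead)

It suffices to show X = REAL ∧ NONMAX (card log-cy-skeleton-certificates, spine and only card), two
statements of
5-dimensional birational geometry. REAL: every triangulated PL (= smooth) homotopy 4-sphere Σ is
PL-homeomorphic to the dual
complex 𝒟(X,B) of a 5-dimensional log Calabi–Yau pair (K_X + B ∼ 0), produced UNIFORMLY in the
triangulation K through a
smoothing of the Stanley–Reisner scheme ℙ(K') of a subdivision (typed crux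
StanleyReisnerRealisation, channel (ii)) or a positive
simple tropical structure on |K| (channel (i), Gross–Siebert), plus the bookkeeping
SkeletonComparison. NONMAX: a 5-fold log
CY pair whose dual complex is a simply connected closed PL 4-manifold has birational complexity
c_bir < 5 (Mauri–Moraga Problem
1.17, sharpened; informal crux NonMax). The bridge is provable: c_bir < 5 gives a crepant
ℚ-factorial dlt model whose simplicial
dual complex is star(v_E) ∪ antistar(v_E) with the antistar COLLAPSED BY THE MMP (MauriMoraga2024
Thm 7.1), and a closed
combinatorial 4-manifold with a collapsible vertex-antistar is PL S⁴ by Whitehead's ball theorem +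
Alexander, removing the
"dim 𝒟 ≠ 4" exclusion of MauriMoraga2024 Thm 1.15 (informal crux BirationalCertificate; no Poincaré
conjecture used). The typed
bridgehead is SkeletonCertificate — what REAL ∧ NONMAX deliver to topology: a smooth triangulation
with a vertex whose antistar is
simplicially collapsible — and recognition of such certificates is known (support). Abstract REAL is
trivially true on PL-standard
spheres: any triangulation K of S⁴ has a subdivision isomorphic to a geometric subdivision T of ∂Δ⁵
⊂ ℝ⁵, and after a small
rational perturbation of its vertices the cones over T form a complete simplicial fan, whose proper
toric pair (X_Σ, ∂X_Σ) is log
Calabi–Yau with dual complex T and complexity 0 — so all of REAL's content is on exotic Σ, while the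
uniform channel statement
(smoothability of ℙ(K') itself, not of some toric boundary) carries independent, checkable content
already for the true S⁴.
(Cone repair, rev 3: in the typed items the clause "the antistar {s ∈ K | v ∉ s} is simplicially
collapsible" is
`Literature.Topology.FourManifolds.IsFaceCollapsible {s ∈ K.faces | v ∉ s}` WRITTEN OUT in Mathlib
primitives — ∃ w, Relation.ReflTransGen
(elementary collapse: remove a free pair σ ⊂ τ, τ.card = σ.card + 1, τ the only face properly
containing σ) from the antistar to {{w}} —
definitionally equal to it (Iff.rfl, checked), so provers may `show IsFaceCollapsible _` and use
Collapsible.lean's API in Theorems files, while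
the route file itself imports only SmoothTriangulation.lean and its own import cone carries no
undischarged named fact.)
Lean: `∀ (M : Type) [TopologicalSpace M] [T2Space M] [SecondCountableTopology M] [ChartedSpace
(EuclideanSpace ℝ (Fin 4)) M] [IsManifold (𝓡 4) (⊤ : ℕ∞) M], M ≃ₕ Metric.sphere (0 : EuclideanSpace
ℝ (Fin 5)) 1 → ∃ (N : ℕ) (K : Geometry.SimplicialComplex ℝ (EuclideanSpace ℝ (Fin N))) (h : K.space
≃ₜ M), Literature.Topology.FourManifolds.IsSmoothTriangulation 4 K h ∧ ∃ v : EuclideanSpace ℝ (Fin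
N), ({v} : Finset (EuclideanSpace ℝ (Fin N))) ∈ K.faces ∧ ∃ w : EuclideanSpace ℝ (Fin N),
Relation.ReflTransGen (fun F G : Set (Finset (EuclideanSpace ℝ (Fin N))) => ∃ σ τ : Finset
(EuclideanSpace ℝ (Fin N)), (σ ∈ F ∧ τ ∈ F ∧ σ ⊂ τ ∧ τ.card = σ.card + 1 ∧ ∀ ρ ∈ F, σ ⊂ ρ → ρ = τ) ∧
G = F \ {σ, τ}) {s ∈ K.faces | v ∉ s} {({w} : Finset (EuclideanSpace ℝ (Fin N)))}`

## Assembly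
Pure logic (sorry-free in the planner's Sketch.lean, axioms propext / Classical.choice / Quot.sound;
certified by `ledger route check
--native`: h21_check_closes ok): `SmoothPoincare4` unfolds to ∀ M (Hausdorff, second countable) [C^∞
atlas on ℝ⁴], M ≃ₕ S⁴ → Nonempty
(M ≃ₘ S⁴); SkeletonCertificate gives the certificate on M and CertificateRecognition returns the
diffeomorphism: `theorem closes
(hT : SkeletonCertificate) (hR : CertificateRecognition) : _root_.SmoothPoincare4 := by intro M _ _
_ _ _ e; exact hR M (hT M e)`.
Upstream (informal, AG): StanleyReisnerRealisation ∧ SkeletonComparison ∧ NonMax ∧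
BirationalCertificate ⇒ SkeletonCertificate. Converse
sanity (also checked): SmoothPoincare4 → SimplexBoundaryCertificate → SkeletonCertificate via
IsSmoothTriangulation.trans_diffeomorph, so
the typed layer neither weakens nor strengthens the summit.

Rationale: WHY THIS LINE. TRANSPLANT from birational geometry with an explicit dictionary (card): homotopy
4-sphere ↦ dual complex / essential skeleton
of a 5-fold log Calabi–Yau pair or maximal CY 4-fold degeneration (KollarXu2015, NicaiseXu2016 Thm
19); diffeomorphism ↦ crepant
birational map (𝒟 is a PL invariant, FernexKollarXu2012 Prop 11, weak factorisation = stellar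
moves); handle cancellation ↦ an MMP
step positive on a boundary divisor, which COLLAPSES the dual complex (FernexKollarXu2012 Thm 19);
S⁴ ↦ toric pairs (c_bir = 0,
MauriMoraga2024 Thm 1.6/1.10); "no Whitney trick" ↦ maximal birational complexity c_bir = 5. The
engine is a well-founded
complexity 4-dimensional topology lacks — termination of the MMP with scaling of a
boundary-supported ample divisor, powered by
positivity (KollarXu2015 Thm 21, MauriMoraga2024 Thm 1.7/7.1) — so the collapse is PRODUCED by
algebra, not searched for (contrast
card collapse-certificates). What the line adds to what it imports: (i) CERT — c_bir < 5 certifies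
PL-standardness in the one
dual-complex dimension Mauri–Moraga exclude (their Prop 2.33 invokes PL Poincaré; Whitehead1939 +
Alexander suffice); (ii) the
relocation SPC4 ⇐ REAL ∧ NONMAX with a negative companion (an exotic Σ that algebraises has c_bir =
5 on every crepant model, against
the expectation behind KollarXu2015 Question 7 / §34 "conjecturally PL"); (iii) a typed, uniform
realisation statement
(StanleyReisnerRealisation) whose deformation theory is combinatorial (AltmannChristophersen2009 Thm
4.6, Prop 4.8, Thm 5.2–5.7;
arXiv:2606.16829 higher cotangent cohomology, 2026); (iv) a degenerate case CHECKED: the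
maximal-complexity family of MauriMoraga2024
Thm 1.18 (polytope quotients, 𝒟 = S⁴/G) never yields a fake PL 4-sphere, since S⁴/G a simply
connected PL manifold forces G
reflection–rotation and S⁴/G ≅_PL S⁴ (Lange2016 main theorem). No SPC4 route or card uses dual
complexes, dlt pairs, the MMP or
toric/tropical degenerations (48 Theses grepped; negatives index empty); the typed layer uses the
Statement's own quantifier shape,
the plain definition IsSmoothTriangulation, simplicial collapsibility spelled out in Mathlib
primitives (IsFaceCollapsible unfolded,
Iff.rfl; rev 3 cone repair — Collapsible.lean and the ClosedBall/Gluing/Cobordism/Isotopy facts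
behind it are no longer imported), and Mathlib
commutative algebra (no unproved fact referenced, none in the route's own import cone).

RANKED CRUXES. Ranked: #2 StanleyReisnerRealisation (typed; REAL's channel (ii), uniform in K — the
most informative attackable statement: false
for one triangulation of S⁴ kills the channel, true for all is a theorem in deformation theory of
face rings); #3
SkeletonCertificate (typed bridgehead, the existence half; ⇔ SPC4 given recognition); then three
INFORMAL cruxes filed as
statement items right after open (no Lean vocabulary for dlt pairs / dual complexes / c_bir —
definition request D2): #4 NonMax
(NONMAX; why it might fail: maximal-complexity coregularity-0 pairs exist in every dimension ≥ 3,
MauriMoraga2024 Thm 1.18/1.19,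
and nothing known excludes a simply connected PL dual complex among them; sources arXiv:2402.10136
Problem 1.17, KollarXu2015
§33–34), #5 BirationalCertificate (CERT: c_bir < n ∧ 𝒟 closed PL (n−1)-manifold ⇒ 𝒟 ≅_PL S^{n−1}
including n−1 = 4; paper-provable
now from the proof of MauriMoraga2024 Thm 7.1 + Whitehead1939 + Alexander; why it might fail: only
if Thm 7.1's collapsible piece
were not literally the simplicial antistar — arXiv:2402.10136 p.24 shows it is 𝒟(X',B'−E)), #6
SkeletonComparison (K3
bookkeeping: compactification + dlt modification of a channel-(i)/(ii) degeneration has Kollár–Xu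
dual complex PL ≅ |K|; why it
might fail: resolving the codimension-2 log-singular locus may add lc centres; sources NicaiseXu2016
Thm 16/19, FernexKollarXu2012
§3). Supports: CertificateRecognition (known PL/DIFF end of the bridge), SimplexBoundaryCertificate
(calibration, c_bir = 0).
#2 StanleyReisnerRealisation (crux) — REAL, channel (ii), uniform in the triangulation (card K2 made
typed): for every smooth triangulation h : |K| ≃ₜ M of a smooth homotopy 4-sphere there is a linear
subdivision K' of K whose Stanley–Reisner scheme ℙ(K') ⊂ ℙ^{f₀−1} (face ring ℂ[x_v : v a
vertex]/I_{K'}, I_{K'} spanned by the monomials of non-faces) admits a FORMAL EMBEDDED SMOOTHING: a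
homogeneous ideal J ⊂ ℂ⟦t⟧[x_v], t-torsion-free (= flat over ℂ⟦t⟧), reducing to I_{K'} mod t, whose
generic fibre over ℂ((t)) is smooth of pure dimension 4 — every minimal prime P ⊇ J with t ∉ P has
height f₀ − 5, and J + I_{f₀−5}(Jacobian) becomes irrelevant after inverting t. By Grothendieck
existence this is smoothability of ℙ(K') in the usual sense; the smooth fibre is a Calabi–Yau 4-fold
degenerating to ℙ(K') with intersection complex K' (AltmannChristophersen2009 §1), handed to
SkeletonComparison and NonMax. Already open and meaningful for M = S⁴: K' may be taken polytopal
(regular refinement), but smoothability of ℙ(∂Q) for a simplicial 5-polytope Q is known only when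
the polar is (nef-)Fano. [difficulty: open-problem] (why it might fail: ℙ(K) is RIGID when all links
are large (AltmannChristophersen2009 Cor 5.8: the 600-cell, one dimension down); smoothing
components may exist only for K' refining a nef-Fano toric boundary, so one bad triangulation of S⁴
itself refutes uniformity (channel (ii) dies, line pivots to channel (i)).)
[AltmannChristophersen2009, arXiv:math/0006139, arXiv:1102.4521, arXiv:2606.16829, GrossSiebert2011,
KollarXu2015]
#3 SkeletonCertificate (crux) — the BRIDGEHEAD (existence half): every Hausdorff second-countable
smooth 4-manifold M homotopy equivalent to S⁴ admits a SKELETON CERTIFICATE — a Whitehead smooth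
triangulation h : |K| ≃ₜ M by a finite Euclidean simplicial complex K and a vertex v of K whose
antistar {s ∈ K | v ∉ s} (K minus the open star of v) is simplicially collapsible. This is what REAL
∧ NONMAX ∧ CERT deliver (MauriMoraga2024 Thm 7.1: 𝒟(X',B') = star(v_E) ∪ 𝒟(X',B'−E), the latter
collapsed by the (K+B'−E)-MMP with scaling), transported to M by FernexKollarXu2012 Prop 11 and
Whitehead1940; conversely SPC4 ⇒ it (∂Δ⁵ on the round sphere, support SimplexBoundaryCertificate;
checked sorry-free in Sketch.lean), so it is ⇔ SPC4 given CertificateRecognition — the typed form of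
X. [deps: StanleyReisnerRealisation] [difficulty: open-problem] (why it might fail: ⇔ SPC4 given
CertificateRecognition: an exotic Σ has no certificate; and even on true S⁴ the certificate reached
from a given triangulation may need non-recursively many stellar moves (Lishak–Nabutovsky-type
floors, arXiv:1610.06130).) [MauriMoraga2024, FernexKollarXu2012, KollarXu2015, Whitehead1939,
Whitehead1940, arXiv:1610.06130]
#9 CertificateRecognition (support) — RECOGNITION (known): a Hausdorff second-countable smooth
4-manifold smoothly triangulated by a finite complex K with a vertex v whose antistar is
simplicially collapsible is diffeomorphic to S⁴. Chain: K is a combinatorial 4-manifold carrying the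
Whitehead PL structure of M (Whitehead1940; Munkres1966 §8–10); antistar(v) = closed complement of
the open star = PL 4-manifold with boundary lk(v); a collapsible PL manifold is a PL ball
(Whitehead1939; RourkeSanderson1972 Cor. 3.27; Lange2016 Lemma 5.7); star(v) = cone on the PL
3-sphere lk(v) = PL ball; ball ∪_∂ ball ≅_PL S⁴ (Alexander; Lange2016 Lemma 5.6); PL = DIFF in
dimension 4 (HirschMazur1974; tree fact nonempty_diffeomorph_of_isWhiteheadCompatible_four). The
PL/DIFF heart of CERT; Literature debt, no open mathematics. [difficulty: XL] [Whitehead1939,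
Whitehead1940, RourkeSanderson1972, HogAngeloniMetzler1993, Lange2016, HirschMazur1974, Munkres1966]
#9 SimplexBoundaryCertificate (support) — CALIBRATION / non-vacuity (the c_bir = 0, toric instance
(ℙ⁵, ΣH_i) of the dictionary, MauriMoraga2024 Thm 1.6/1.10): the round S⁴ ⊂ ℝ⁵ with Mathlib's smooth
structure carries a skeleton certificate — the boundary complex of a 5-simplex centred at 0,
radially projected (a smooth immersion on each closed simplex); the antistar of any vertex is the
opposite closed 4-simplex with all its faces, which collapses to a vertex. [difficulty: M]
[Whitehead1940, Munkres1966, MauriMoraga2024]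

TWO-LAYER PLAN. Foreseen glued splits (k ≤ 3, depth 1; nothing filed now): StanleyReisnerRealisation
⇐ PolytopalRefinement (every smooth
triangulation of a smooth homotopy 4-sphere has a subdivision combinatorially equivalent to the
boundary of a simplicial 5-polytope
— conforming-regular refinement; typed) → PolytopalSmoothing (ℙ(∂Q) is smoothable for every
simplicial 5-polytope Q; typed as above)
→ StanleyReisnerRealisation; SkeletonCertificate ⇐ StanleyReisnerRealisation → [SkeletonComparison ∧
NonMax ∧ BirationalCertificate,
once D2 lands] → SkeletonCertificate; CertificateRecognition ⇐ AntistarIsPLManifold →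
CollapsibleManifoldIsBall → TwoBallsSmoothing.
Alternative children of REAL if channel (ii) dies: TropicalRealisation (positive simple tropical
structure on |K|, GrossSiebert2011,
FeltenFilipRuddat2021 Thm 1.1) in place of StanleyReisnerRealisation.

KILL CRITERIA. StanleyReisnerRealisation REFUTED by one smooth triangulation of S⁴ none of whose
subdivisions has smoothable ℙ(K') ⇒ channel (ii)
dead: restate REAL through channel (i) (TropicalRealisation) or, if that is shown vacuous beyond
polytopal presentations too, close
the route exhausted with the census "REAL carries no uniform content; abstract REAL ⇔ SPC4 given
NONMAX" and hand CERT + the negative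
companion "exotic ⇒ c_bir = 5" to the barrier catalogue. NonMax refuted (a 5-fold log CY pair with
simply connected closed PL 𝒟 and
c_bir = 5): close refuted:NonMax unless its 𝒟 is itself news (a new standardness proof or an exotic
sphere). SkeletonCertificate can
only be refuted together with SPC4. BirationalCertificate's reading of Thm 7.1 wrong ⇒ repair
through the regular-neighbourhood form.
Any SPC4 proof elsewhere moots the route; a proof of Problem 1.17 in dimension 5 leaves REAL as the
whole route.

NOT DECOMPOSED YET. The AG layer (NonMax, BirationalCertificate, SkeletonComparison stay informal
until D2; their signatures are the grounders' first
task once it lands); PolytopalRefinement / PolytopalSmoothing (children of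
StanleyReisnerRealisation, above); the transfer lemma
"PL-homeomorphic good complex ⇒ smooth triangulation by a good complex" (absorbed:
SkeletonCertificate quantifies over all smooth
triangulations, recognition is PL-invariant); the PL plumbing of CertificateRecognition (antistar is
a PL manifold with boundary;
Newman/Alexander; smoothing uniqueness) — provers attach these with --supports; the tropical
channel's definitions.

CHEAPEST FALSIFIER. Cheapest first. (1) DONE, survived: the card's named risk for NONMAX — non-free
polytope quotients (MauriMoraga2024 Thm 1.18 family)
— cannot yield a fake PL 4-sphere: Lange2016 (main theorem + Lemmas 5.3–5.8, read) gives S⁴/G ≅_PL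
S⁴ whenever S⁴/G is a simply
connected closed PL 4-manifold, G < O(5) finite. (2) OWED, computable (Macaulay2 VersalDeformations;
not on the farm): smoothability
of ℙ(K') for SMALL 4-SPHERES that are not nef-Fano toric boundaries — start with ∂C(7,5), ∂C(8,5)
and the bistellar descendants of
∂β₅ from the card's kit job j000430 (T¹ ≠ 0 there: 243, 144, 105–124), compute T²_{A_K,0} by
AltmannChristophersen2009 Prop 4.8 and
the quadratic obstruction map; and one dimension down decide whether the rigid ℙ(∂{3,3,5}) (Cor 5.8
/ Ex 5.9) acquires a smoothing
after one or two stellar subdivisions. A 4-sphere with ≤ 9 vertices none of whose subdivisions with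
≤ 12 vertices smooths would
already refute StanleyReisnerRealisation as stated (uniformity), at S⁴ itself.

NUMBERS. Complexity c(X,B) = dim X + rank Cl(X)_ℚ − |B| ≥ 0 (BMSZ18; MauriMoraga2024 §1.1); c_bir =
min over crepant models; c_bir < 5 ⟺ a
ℚ-factorial dlt crepant model with |B'| ≥ ρ(X') + 1; six big boundary components ⇒ 𝒟 ≅_PL ∂Δ⁵ (Thm
1.10); c_bir = 0 ⟺
crepant-birational to (ℙ⁵, 6 hyperplanes) (Thm 1.6). Known range of the algebro-geometric Poincaré
conjecture (Conj. 1.13): dim X ≤ 4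
(KollarXu2015), dim 5 snc; Thm 1.15 PL only for dim 𝒟 ≠ 4. AltmannChristophersen2009: dim T¹_{ℙ(K)}
for 3-manifolds K = 11d₃ + 5e₃ +
3e₄ + e_{≥5} + c_{≥6} + 5f₁^{(3)} + 2f₁^{(4)} + h²(K) (Thm 5.7); ℙ(K) rigid if H²(K) = 0 and all
edge valencies ≥ 5 (Cor 5.8). Card toy
(kit j000430): dim T¹_{A_K,0} = 431, 160, 243, 144, 177, 112 for ∂Δ⁵, ∂β₅, ∂C(7,5), ∂C(8,5),
∂C(9,5), S⁰∗∂C(7,4), and 105–124 on six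
bistellar descendants of ∂β₅. Dehn–Sommerville for simplicial 4-spheres: f₄ = 2 + 2h₁ + 2h₂, f₂ = 10
+ 6h₁ + 4h₂, so 4-simplices per
triangle average 10f₄/f₂ ∈ [3,5). Lange2016: for finite G < O(n), ℝⁿ/G is a PL manifold (with
boundary) iff G is reflection–rotation,
then ≅_PL ℝⁿ or a half-space (all n, incl. 5). In StanleyReisnerRealisation: codimension of the cone
f₀ − 5, height of generic minimal
primes f₀ − 5 in ℂ⟦t⟧[x] (Krull dim f₀ + 1, cone dim 5 + 1). Items at open: 5 typed (2 cruxes, 2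
support, assembly) + 3 informal cruxes = 8.

DEFINITION REQUESTS. D2 (kind definition, topic Literature/AlgebraicGeometry/LogCalabiYau; heavy;
unblocks NonMax, BirationalCertificate,
SkeletonComparison): lc / dlt pair, log Calabi–Yau pair (K_X + B ∼ 0), crepant birational map, dual
complex 𝒟(X,B) of a dlt pair as
a regular Δ-complex (KollarXu2015 §2, MauriMoraga2024 Def. 2.20–2.21), birational complexity (Def.
2.27–2.28). D3 (kind definition,
topic Literature/AlgebraicGeometry/StanleyReisner; definable now, would shorten
StanleyReisnerRealisation tenfold): face ring A_K of a
finite abstract simplicial complex, its Proj ℙ(K), `IsFormalEmbeddedSmoothing J I` (the five clauses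
of the crux), and the
Altmann–Christophersen graded pieces T¹_{a−b}, T²_{a−b} as certified computations. D1 (kind
definition, topic
Literature/Topology/FourManifolds): abstract-complex toolkit next to Collapsible.lean — stellar
subdivision / weld, combinatorial
n-manifold, deletion/antistar, PL homeomorphism of polyhedra. Cite facts wanted: Whitehead1939 "a
collapsible PL manifold is a PL
ball" (RourkeSanderson1972 Cor. 3.27); Lange2016 main theorem; MauriMoraga2024 Thm 7.1 and
FernexKollarXu2012 Prop 11 / Thm 19
(informal until D2).

Novelty: Searches (2026-08-15, this seat; local hybrid index DOWN rc 75, OpenAlex 429): `lit search --source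
zbmath` "dual complex log
Calabi-Yau pair PL sphere" (1: KollarXu2015), "exotic 4-sphere dual complex degeneration Calabi-Yau"
(0), "birational complexity dual
complex collapsible" (0), "dual complex Calabi-Yau" --year-from 2015 (10; KollarXu2015, GHK only
relevant), "Stanley-Reisner
smoothing Calabi-Yau sphere" (0), "collapsible PL manifold ball triangulated 4-sphere vertex" (0),
"Lange reflections rotations" (2:
Lange2016 + Lange–Mikhaîlova — READ arXiv:1509.06771 pp.3,8–11), "Christophersen Stanley-Reisner"
(9: AltmannChristophersen2009,
arXiv:math/0006139, arXiv:1102.4521, arXiv:1202.0510, arXiv:2606.16829 …); `lit search --source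
arxiv` three queries (0 each, then
429); `lit galaxy search "dual complex of Calabi-Yau pairs sphere" --star all` (0/0/0); `lit
frontier SmoothPoincare4 --since 2022` (30
rows, nothing algebro-geometric; arXiv:2603.23717, arXiv:2412.04768); `lit bridges SmoothPoincare4
--cross any` (no bridge to birational
geometry); READ arXiv:2402.10136 pp.3–6, 12, 24–25, 28 and arXiv:0901.2502 pp.3, 8–12; plus the
card's own search log and a grep of
all 48 SPC4 Theses / 149 cards for dual complex / MMP / Calabi–Yau / Stanley–Reisner (none).
Nearest prior art found: arXiv:2402.10136 = MauriMoraga2024 (Thm 1.15/7.1/7.2, Prop 2.33 — the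
engine, excluding dim 𝒟 = 4 via PL
Poincaré; Problem 1.17; Thm 1.18/1.19), KollarXu2015 §33–34 / Question 7, FernexKollarXu2012 P  [refs: 1509.06771, math/0006139, 1102.4521, 1202.0510, 2606.16829, 2603.23717, 2412.04768, 2402.10136, 0901.2502, KollarXu2015, Lange2016, AltmannChristophersen2009, MauriMoraga2024, FernexKollarXu2012, NicaiseXu2016, FeltenFilipRuddat2021, GrossSiebert2011]

Barriers (technique_class: birational-mmp, dual-complex-realisation, pl-collapse): - technique_class: birational-mmp, dual-complex-realisation, pl-collapse
- Literature.Barriers.SmoothPoincare4.GaugeSumBarrierFour: outside the class — no invariant of Σ or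
of Σ # Y is computed; the output is a PL homeomorphism assembled from stellar moves (weak
factorisation) and elementary collapses (MMP steps) read off an auxiliary algebraic 5-fold.
- Literature.Barriers.SmoothPoincare4.HCobordismInvariantBarrierFour: outside the class (nothing
factors through an h-cobordism class); likewise StableBarrierFour and GluckTwistCP2Barrier (no
stabilisation, no ℂℙ²-sum).
- Literature.Barriers.SmoothPoincare4.TopologicalBarrierFour: evaded by construction — the
certificate and the realisation are attached to a SMOOTH (Whitehead) triangulation of the given
structure; with a merely topological triangulation SkeletonCertificate would be Freedman's theorem
and recognition would contain SPC4.
- Literature.Barriers.SmoothPoincare4.TwistedSphereBarrierFour: not leaned on — the final gluing is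
two PL balls along their common boundary (Alexander trick in PL, every dimension), not a smooth
twisted sphere; Γ₄ = 0 is unused; the difficulty sits upstream in producing the collapse (AG), which
the barrier does not address.
- Literature.Barriers.SmoothPoincare4.HCobordismBarrierFour: not invoked — no h-cobordism,
handle-trading or cork argument anywhere.
- Literature.Barriers.SmoothPoincare4.LowGenusTrisectionBarrier: orthogonal complexity (birational
complexity of an algebraisation, not trisect

History (route lifecycle, newest last):
- 2026-08-15T19:51:12Z · rev 3: restated SkeletonCertificate (stmt-SmoothPoincare4-13645), CertificateRecognition (stmt-SmoothPoincare4-13646), SimplexBoundaryCertificate (stmt-SmoothPoincare4-13647) — cone repair (rrepair-SmoothPoincare4-LogCYSkeleton-bf1b19eb): drop import Literature.Topology.FourManifolds.Collapsible — its cone (ClosedBall→ (planner-rrepair-SmoothPoincare4-LogCYSkeleton-bf1b19eb-0)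
- 2026-08-15T23:12:47Z · CLOSED retired — refuted on paper: NonMax (stmt-SmoothPoincare4-13664, informal crux, no signature ⇒ no refuting theorem can land; gate refuses --as refuted) — refuter-rattack-stmt-SmoothPoincare4-13664-0 ATTACK.md v2 (planner-rchoice-SmoothPoincare4-LogCYSkeleton--9a00422e-0)

sub-problem: SmoothPoincare4 · status: closed(retired) · opened planner-plancard-SmoothPoincare4-SmoothPoinca-029e2a39-0 2026-08-15T19:30:20Z · rev 3 · ledger route-SmoothPoincare4-LogCYSkeleton
GENERATED by the gate from the ledger (D-0016/17). Provers cite these decls: `theorem foo : Summit.SmoothPoincare4.SmoothPoincare4.Theses.LogCYSkeleton.<Decl> := …` in Summits/SmoothPoincare4/SmoothPoincare4/Theorems/<Name>.lean.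
-/

namespace Summit.SmoothPoincare4.SmoothPoincare4.Theses.LogCYSkeleton

open scoped BigOperators Topology Manifold Classical MeasureTheory ProbabilityTheory Matrix InnerProductSpace ComplexConjugate ContinuousMap
open Filter Set Function TopologicalSpace MeasureTheory

attribute [summit_statement] _root_.SmoothPoincare4

open Literature.SPC4

/-- item stmt-SmoothPoincare4-13644 · crux · rank 2 · closed · moot by None · by planner
why it might fail: ℙ(K) is RIGID when all links are large (AltmannChristophersen2009 Cor 5.8: the 600-cell, one dimension down); smoothing components may exist only for K' refining a nef-Fano toric boundary, so one bad triangulation of S⁴ itself refutes uniformity (channel (ii) dies, line pivots to channel (i)).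
sources: AltmannChristophersen2009, arXiv:math/0006139, arXiv:1102.4521, arXiv:2606.16829, GrossSiebert2011, KollarXu2015
[crux] REAL, channel (ii), uniform in the triangulation (card K2 made typed): for every smooth
triangulation h : |K| ≃ₜ M of a smooth homotopy 4-sphere there is a linear subdivision K' of K whose
Stanley–Reisner scheme ℙ(K') ⊂ ℙ^{f₀−1} (face ring ℂ[x_v : v a vertex]/I_{K'}, I_{K'} spanned by the
monomials of non-faces) admits a FORMAL EMBEDDED SMOOTHING: a homogeneous ideal J ⊂ ℂ⟦t⟧[x_v],
t-torsion-free (= flat over ℂ⟦t⟧), reducing to I_{K'} mod t, whose generic fibre over ℂ((t)) is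
smooth of pure dimension 4 — every minimal prime P ⊇ J with t ∉ P has height f₀ − 5, and J +
I_{f₀−5}(Jacobian) becomes irrelevant after inverting t. By Grothendieck existence this is
smoothability of ℙ(K') in the usual sense; the smooth fibre is a Calabi–Yau 4-fold degenerating to
ℙ(K') with intersection complex K' (AltmannChristophersen2009 §1), handed to SkeletonComparison and
NonMax. Already open and meaningful for M = S⁴: K' may be taken polytopal (regular refinement), but
smoothability of ℙ(∂Q) for a simplicial 5-polytope Q is known only when the polar is (nef-)Fano.
[difficulty: open-problem] -/
@[route_item "route-SmoothPoincare4-LogCYSkeleton"]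
def StanleyReisnerRealisation : Prop :=
  ∀ (M : Type) [TopologicalSpace M] [T2Space M] [SecondCountableTopology M] [ChartedSpace (EuclideanSpace ℝ (Fin 4)) M] [IsManifold (𝓡 4) (⊤ : ℕ∞) M], M ≃ₕ Metric.sphere (0 : EuclideanSpace ℝ (Fin 5)) 1 → ∀ (N : ℕ) (K : Geometry.SimplicialComplex ℝ (EuclideanSpace ℝ (Fin N))) (h : K.space ≃ₜ M), Literature.Topology.FourManifolds.IsSmoothTriangulation 4 K h → ∃ K' : Geometry.SimplicialComplex ℝ (EuclideanSpace ℝ (Fin N)), K'.faces.Finite ∧ K'.space = K.space ∧ (∀ s' ∈ K'.faces, ∃ s ∈ K.faces, convexHull ℝ (s' : Set (EuclideanSpace ℝ (Fin N))) ⊆ convexHull ℝ (s : Set (EuclideanSpace ℝ (Fin N)))) ∧ ∃ J : Ideal (MvPolynomial {p : EuclideanSpace ℝ (Fin N) // ({p} : Finset (EuclideanSpace ℝ (Fin N))) ∈ K'.faces} (PowerSeries ℂ)), (∀ f ∈ J, ∀ d : ℕ, MvPolynomial.homogeneousComponent d f ∈ J) ∧ (∀ f, MvPolynomial.C PowerSeries.X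 * f ∈ J → f ∈ J) ∧ Ideal.map (MvPolynomial.map (PowerSeries.constantCoeff (R := ℂ))) J = Ideal.span {m | ∃ S : Finset {p : EuclideanSpace ℝ (Fin N) // ({p} : Finset (EuclideanSpace ℝ (Fin N))) ∈ K'.faces}, S.Nonempty ∧ S.map (Function.Embedding.subtype _) ∉ K'.faces ∧ m = ∏ v ∈ S, MvPolynomial.X v} ∧ (∀ P ∈ J.minimalPrimes, MvPolynomial.C PowerSeries.X ∉ P → P.height = ({p : EuclideanSpace ℝ (Fin N) | ({p} : Finset (EuclideanSpace ℝ (Fin N))) ∈ K'.faces}.ncard - 5 : ℕ)) ∧ ∀ v : {p : EuclideanSpace ℝ (Fin N) // ({p} : Finset (EuclideanSpace ℝ (Fin N))) ∈ K'.faces}, ∃ k m : ℕ, MvPolynomial.C PowerSeries.X ^ m * MvPolynomial.X v ^ k ∈ J ⊔ Ideal.span {d | ∃ (g : Fin ({p : EuclideanSpace ℝ (Fin N) | ({p} : Finset (EuclideanSpace ℝ (Fin N))) ∈ K'.faces}.ncard - 5) → MvPolynomial {p : EuclideanSpace ℝ (Fin N) // ({p} : Finset (EuclideanSpace ℝ (Fin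 N))) ∈ K'.faces} (PowerSeries ℂ)) (c : Fin ({p : EuclideanSpace ℝ (Fin N) | ({p} : Finset (EuclideanSpace ℝ (Fin N))) ∈ K'.faces}.ncard - 5) → {p : EuclideanSpace ℝ (Fin N) // ({p} : Finset (EuclideanSpace ℝ (Fin N))) ∈ K'.faces}), (∀ i, g i ∈ J) ∧ Function.Injective c ∧ d = Matrix.det (Matrix.of fun i j => MvPolynomial.pderiv (c j) (g i))}

-- earlier SkeletonCertificate (stmt-SmoothPoincare4-13645, replaced 2026-08-15T19:51:12Z -> stmt-SmoothPoincare4-13641): retired by None — ∀ (M : Type) [TopologicalSpace M] [T2Space M] [SecondCountableTopology M] [ChartedSpace (EuclideanSpace ℝ (Fin 4)) M] [IsManifold (𝓡 4) (⊤ : ℕ∞) M], M ≃ₕ Metric.sphere (0 : EuclideanSpace ℝ (Fin 5)) 1 → ∃ (N : ℕ) (K : Geometry.SimplicialComplex ℝ (EuclideanSpace 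
/-- item stmt-SmoothPoincare4-13641 · crux · rank 3 · closed · moot by None · by planner
why it might fail: ⇔ SPC4 given CertificateRecognition: an exotic Σ has no certificate; and even on true S⁴ the certificate reached from a given triangulation may need non-recursively many stellar moves (Lishak–Nabutovsky-type floors, arXiv:1610.06130).
sources: MauriMoraga2024, FernexKollarXu2012, KollarXu2015, Whitehead1939, Whitehead1940, arXiv:1610.06130
[crux] the BRIDGEHEAD (existence half): every Hausdorff second-countable smooth 4-manifold M
homotopy equivalent to S⁴ admits a SKELETON CERTIFICATE — a Whitehead smooth triangulation h : |K|
≃ₜ M by a finite Euclidean simplicial complex K and a vertex v of K whose antistar {s ∈ K | v ∉ s}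
(K minus the open star of v) is simplicially collapsible. This is what REAL ∧ NONMAX ∧ CERT deliver
(MauriMoraga2024 Thm 7.1: 𝒟(X',B') = star(v_E) ∪ 𝒟(X',B'−E), the latter collapsed by the
(K+B'−E)-MMP with scaling), transported to M by FernexKollarXu2012 Prop 11 and Whitehead1940;
conversely SPC4 ⇒ it (∂Δ⁵ on the round sphere, support SimplexBoundaryCertificate; checked
sorry-free in Sketch.lean), so it is ⇔ SPC4 given CertificateRecognition — the typed form of X.
[deps: StanleyReisnerRealisation] [difficulty: open-problem] -/
@[route_item "route-SmoothPoincare4-LogCYSkeleton"]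
def SkeletonCertificate : Prop :=
  ∀ (M : Type) [TopologicalSpace M] [T2Space M] [SecondCountableTopology M] [ChartedSpace (EuclideanSpace ℝ (Fin 4)) M] [IsManifold (𝓡 4) (⊤ : ℕ∞) M], M ≃ₕ Metric.sphere (0 : EuclideanSpace ℝ (Fin 5)) 1 → ∃ (N : ℕ) (K : Geometry.SimplicialComplex ℝ (EuclideanSpace ℝ (Fin N))) (h : K.space ≃ₜ M), Literature.Topology.FourManifolds.IsSmoothTriangulation 4 K h ∧ ∃ v : EuclideanSpace ℝ (Fin N), ({v} : Finset (EuclideanSpace ℝ (Fin N))) ∈ K.faces ∧ ∃ w : EuclideanSpace ℝ (Fin N), Relation.ReflTransGen (fun F G : Set (Finset (EuclideanSpace ℝ (Fin N))) => ∃ σ τ : Finset (EuclideanSpace ℝ (Fin N)), (σ ∈ F ∧ τ ∈ F ∧ σ ⊂ τ ∧ τ.card = σ.card + 1 ∧ ∀ ρ ∈ F, σ ⊂ ρ → ρ = τ) ∧ G = F \ {σ, τ}) {s ∈ K.faces | v ∉ s} {({w} : Finset (EuclideanSpace ℝ (Fin N)))}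

-- item stmt-SmoothPoincare4-13664 · crux · rank 4 · closed · moot by None · by planner — informal only, no Lean statement yet:
--   [crux] NONMAX (card K1; the second conjunct of X = REAL ∧ NONMAX; informal until definition request
--   D2 — dlt pair, dual complex, c_bir — lands): every 5-dimensional log Calabi–Yau pair (X,B) — X
--   proper over ℂ, (X,B) log canonical, B reduced, K_X + B ∼ 0 — whose dual complex 𝒟(X,B) is a simply
--   connected closed PL 4-manifold has birational complexity c_bir(X,B) < 5, equivalently admits a
--   ℚ-factorial dlt crepant model (X',B') with |B'| ≥ ρ(X') + 1 (MauriMoraga2024 §2.6). Sharpens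
--   Mauri–Moraga Problem 1.17 (coregularity 0, c_bir = dim X, 𝒟 a PL manifold ⇒ 𝒟 is a finite quotient
--   of a sphere) and Ko

-- item stmt-SmoothPoincare4-13665 · crux · rank 5 · closed · moot by None · by planner — informal only, no Lean statement yet:
--   [crux] CERT (card P1; the bridge theorem, paper-provable now, Lean-blocked on D2): if (X,B) is an
--   n-dimensional log Calabi–Yau pair with c_bir(X,B) < n and 𝒟(X,B) is a closed PL (n−1)-manifold, then
--   𝒟(X,B) ≅_PL S^{n−1} — INCLUDING dim 𝒟 = 4, where MauriMoraga2024 Thm 1.15/7.2 stop at homeomorphism.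
--   Proof sketch: proof of Thm 7.1 (arXiv:2402.10136 p.24): a crepant ℚ-factorial dlt model (X',B') with
--   B' = E + (B'−E) and 𝒟(X',B') simplicial, 𝒟(X',B') = 𝒟(X',F) ∪ 𝒟(X',B'−E) where 𝒟(X',F) is the closed
--   star of v_E and 𝒟(X',B'−E) (the antistar of v_E) is collapsible, because each step of the (K_{X'}+

-- item stmt-SmoothPoincare4-13667 · crux · rank 6 · closed · moot by None · by planner — informal only, no Lean statement yet:
--   [crux] SKELETON COMPARISON (card K3, the bookkeeping between the typed crux
--   StanleyReisnerRealisation / the tropical channel and NONMAX): for a one-parameter degeneration 𝔛 → Δ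
--   of Calabi–Yau 4-folds obtained from channel (i) (Gross–Siebert / Felten–Filip–Ruddat smoothing of a
--   toric log CY space X₀(|K|,𝒫)) or channel (ii) = the formal embedded smoothing of ℙ(K') supplied by
--   StanleyReisnerRealisation (algebraised over a curve germ by Grothendieck existence; INTERSECTION
--   complex K', dual intersection complex the dual cell complex of K') of REAL, a projective
--   compactification over a curve followed

-- earlier CertificateRecognition (stmt-SmoothPoincare4-13646, replaced 2026-08-15T19:51:12Z -> stmt-SmoothPoincare4-13642): retired by None — ∀ (M : Type) [TopologicalSpace M] [T2Space M] [SecondCountableTopology M] [ChartedSpace (EuclideanSpace ℝ (Fin 4)) M] [IsManifold (𝓡 4) (⊤ : ℕ∞) M], (∃ (N : ℕ) (K : Geometry.SimplicialComplex ℝ (EuclideanSpace ℝ (Fin N))) (h : K.space ≃ₜ M), Literature.Topolog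
/-- item stmt-SmoothPoincare4-13642 · support · rank 9 · closed · moot by None · by planner
sources: Whitehead1939, Whitehead1940, RourkeSanderson1972, HogAngeloniMetzler1993, Lange2016, HirschMazur1974
[support] RECOGNITION (known): a Hausdorff second-countable smooth 4-manifold smoothly triangulated
by a finite complex K with a vertex v whose antistar is simplicially collapsible is diffeomorphic to
S⁴. Chain: K is a combinatorial 4-manifold carrying the Whitehead PL structure of M (Whitehead1940;
Munkres1966 §8–10); antistar(v) = closed complement of the open star = PL 4-manifold with boundary
lk(v); a collapsible PL manifold is a PL ball (Whitehead1939; RourkeSanderson1972 Cor. 3.27;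
Lange2016 Lemma 5.7); star(v) = cone on the PL 3-sphere lk(v) = PL ball; ball ∪_∂ ball ≅_PL S⁴
(Alexander; Lange2016 Lemma 5.6); PL = DIFF in dimension 4 (HirschMazur1974; tree fact
nonempty_diffeomorph_of_isWhiteheadCompatible_four). The PL/DIFF heart of CERT; Literature debt, no
open mathematics. [difficulty: XL] -/
@[route_item "route-SmoothPoincare4-LogCYSkeleton"]
def CertificateRecognition : Prop :=
  ∀ (M : Type) [TopologicalSpace M] [T2Space M] [SecondCountableTopology M] [ChartedSpace (EuclideanSpace ℝ (Fin 4)) M] [IsManifold (𝓡 4) (⊤ : ℕ∞) M], (∃ (N : ℕ) (K : Geometry.SimplicialComplex ℝ (EuclideanSpace ℝ (Fin N))) (h : K.space ≃ₜ M), Literature.Topology.FourManifolds.IsSmoothTriangulation 4 K h ∧ ∃ v : EuclideanSpace ℝ (Fin N), ({v} : Finset (EuclideanSpace ℝ (Fin N))) ∈ K.faces ∧ ∃ w : EuclideanSpace ℝ (Fin N), Relation.ReflTransGen (fun F G : Set (Finset (EuclideanSpace ℝ (Fin N))) => ∃ σ τ : Finset (EuclideanSpace ℝ (Fin N)), (σ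 ∈ F ∧ τ ∈ F ∧ σ ⊂ τ ∧ τ.card = σ.card + 1 ∧ ∀ ρ ∈ F, σ ⊂ ρ → ρ = τ) ∧ G = F \ {σ, τ}) {s ∈ K.faces | v ∉ s} {({w} : Finset (EuclideanSpace ℝ (Fin N)))}) → Nonempty (Diffeomorph (𝓡 4) (𝓡 4) M (Metric.sphere (0 : EuclideanSpace ℝ (Fin 5)) 1) (⊤ : ℕ∞))

-- earlier SimplexBoundaryCertificate (stmt-SmoothPoincare4-13647, replaced 2026-08-15T19:51:12Z -> stmt-SmoothPoincare4-13643): retired by None — ∃ (N : ℕ) (K : Geometry.SimplicialComplex ℝ (EuclideanSpace ℝ (Fin N))) (h : K.space ≃ₜ Metric.sphere (0 : EuclideanSpace ℝ (Fin 5)) 1), Literature.Topology.FourManifolds.IsSmoothTriangulation 4 K h ∧ ∃ v : EuclideanSpace ℝ (Fin N), ({v} : Finset (Euclidea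
/-- item stmt-SmoothPoincare4-13643 · support · rank 9 · closed · moot by None · by planner
sources: Whitehead1940, Munkres1966, MauriMoraga2024
[support] CALIBRATION / non-vacuity (the c_bir = 0, toric instance (ℙ⁵, ΣH_i) of the dictionary,
MauriMoraga2024 Thm 1.6/1.10): the round S⁴ ⊂ ℝ⁵ with Mathlib's smooth structure carries a skeleton
certificate — the boundary complex of a 5-simplex centred at 0, radially projected (a smooth
immersion on each closed simplex); the antistar of any vertex is the opposite closed 4-simplex with
all its faces, which collapses to a vertex. [difficulty: M] -/
@[route_item "route-SmoothPoincare4-LogCYSkeleton"]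
def SimplexBoundaryCertificate : Prop :=
  ∃ (N : ℕ) (K : Geometry.SimplicialComplex ℝ (EuclideanSpace ℝ (Fin N))) (h : K.space ≃ₜ Metric.sphere (0 : EuclideanSpace ℝ (Fin 5)) 1), Literature.Topology.FourManifolds.IsSmoothTriangulation 4 K h ∧ ∃ v : EuclideanSpace ℝ (Fin N), ({v} : Finset (EuclideanSpace ℝ (Fin N))) ∈ K.faces ∧ ∃ w : EuclideanSpace ℝ (Fin N), Relation.ReflTransGen (fun F G : Set (Finset (EuclideanSpace ℝ (Fin N))) => ∃ σ τ : Finset (EuclideanSpace ℝ (Fin N)), (σ ∈ F ∧ τ ∈ F ∧ σ ⊂ τ ∧ τ.card = σ.card + 1 ∧ ∀ ρ ∈ F, σ ⊂ ρ → ρ = τ) ∧ G = F \ {σ, τ}) {s ∈ K.faces | v ∉ s} {({w} : Finset (EuclideanSpace ℝ (Fin N)))}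

/-- item stmt-SmoothPoincare4-13648 · assembly · rank 1 · closed · moot by None · by planner
sources: Whitehead1940, HirschMazur1974
[assembly] SkeletonCertificate → CertificateRecognition → SmoothPoincare4. -/
@[route_item "route-SmoothPoincare4-LogCYSkeleton"]
def Assembly : Prop :=
  SkeletonCertificate → CertificateRecognition → _root_.SmoothPoincare4

end Summit.SmoothPoincare4.SmoothPoincare4.Theses.LogCYSkeleton
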